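import Literature.MathematicalPhysics.QuantumFieldTheory.QCDPhaseQuenchedMomentUpgrade
import Literature.MathematicalPhysics.QuantumFieldTheory.QCDHeavyQuarkPropagator

/-!
# Phase-quenched `(1+ε)`-moments of every propagator entry are finite
(crux stmt-QuantumFields-9151 `PauliWegnerSea.PhaseQuenchedFlavourDecay`, line `crossing-split-integrability`,
lead c4 — registered additive stub `stub_entryMomentIntegrable`, here modulo the negative-moment input)

Given the uniform-window negative-moment statement `WilsonDetNegMoment` (integrability of `‖det D_W(U;M)‖^{-s}`
under the Wilson measure for `0 < s < s₀`, all `L ≥ 4`, `β`, `M` — proved in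
`…WilsonDetNegMoment` from the circle-transport small balls), every same-flavour entry of the `N_f`-flavour
propagator `(diracMatrix U mq)⁻¹` has a finite phase-quenched `(1+ε)`-th moment for `0 < ε < s₀`, on every torus of
side `≥ 4`, for every `β` and every mass vector: the INTEGRABILITY conjunct of `MinorMoments` at `r = 1` (and of
`GramMoments` at `r = 1` by subadditivity), with an exponent window independent of the volume, `β` and the masses.
Mechanism: `∏_g |det D_g| · |G_f(p,q)|^{1+ε} ≤ (∏_{g≠f} |det D_g|) · (|det D_f| |D_f⁻¹(p,q)|)^{1+ε} · |det D_f|^{-ε}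
≤ const · |det D_f|^{-ε}` (adjugate entries and determinants are bounded on the compact configuration space).
-/

noncomputable section

namespace Summit.QuantumFields.QCD.Cruxes.PhaseQuenchedFlavourDecay.CrossingSplitIntegrability

open scoped BigOperators ENNReal
open MeasureTheory Filter Set
open Literature.MathematicalPhysics.QuantumFieldTheory Literature.MathematicalPhysics.QuantumLattice
  Literature.Probability.LatticeModels

section Input

/-! The negative-moment input is a section hypothesis `h` (= the statement of the registered stub
`stub_wilsonDetNegMoment`, proved in `…WilsonDetNegMoment[Final]`). -/
variable
  (h : ∃ s₀ : ℝ, 0 < s₀ ∧ ∀ s : ℝ, 0 < s → s < s₀ → ∀ (L : ℕ) [NeZero L], 4 ≤ L → ∀ (β M : ℝ),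
    Integrable (fun U : GaugeConfig 4 L SU3 => ‖(wilsonDirac (fundamentalRep (Fin 3)) U M 1).det‖ ^ (-s))
      (wilsonMeasure (fundamentalRep (Fin 3)) β))

variable {Nf L : ℕ} [NeZero L]

/-- **Pointwise domination of the reweighted entry moment**: with `A ≥ sup ‖adj(D_f)(p,q)‖` and
`B ≥ ∏_{g ≠ f} ‖det D_g‖` (bounds on the compact configuration space),
`(∏_g ‖det D_g U‖) · ‖G_f(p,q)‖^{1+ε} ≤ B · A^{1+ε} · ‖det D_f U‖^{-ε}`. -/
theorem prod_norm_det_mul_entry_rpow_le (U : GaugeConfig 4 L SU3) (mq : Fin Nf → ℝ) (f : Fin Nf)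
    (p q : QuarkIdx L) {ε A B : ℝ} (hε : 0 < ε)
    (hA : ‖(wilsonDirac (fundamentalRep (Fin 3)) U (mq f) 1).adjugate p q‖ ≤ A)
    (hB : ∏ g ∈ Finset.univ.erase f, ‖(wilsonDirac (fundamentalRep (Fin 3)) U (mq g) 1).det‖ ≤ B)
    (hB0 : 0 ≤ B) :
    (∏ g, ‖(wilsonDirac (fundamentalRep (Fin 3)) U (mq g) 1).det‖) *
        ‖(diracMatrix U mq)⁻¹ (quarkEquiv (f, p)) (quarkEquiv (f, q))‖ ^ (1 + ε) ≤
      B * A ^ (1 + ε) * ‖(wilsonDirac (fundamentalRep (Fin 3)) U (mq f) 1).det‖ ^ (-ε) := by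
  set Df := wilsonDirac (fundamentalRep (Fin 3)) U (mq f) 1 with hDf
  have hA0 : 0 ≤ A := (norm_nonneg _).trans hA
  -- same-flavour entries of `(diracMatrix U mq)⁻¹` are dominated by the one-flavour propagator entry (equality off the
  -- singular set, `0 ≤ ·` on it; cf. `norm_inv_diracMatrix_apply_le_norm_inv_wilsonDirac` of the spectral-reduction file)
  have hentry : ‖(diracMatrix U mq)⁻¹ (quarkEquiv (f, p)) (quarkEquiv (f, q))‖ ≤ ‖Df⁻¹ p q‖ := by
    by_cases hall : ∀ g, (wilsonDirac (fundamentalRep (Fin 3)) U (mq g) 1).det ≠ 0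
    · rw [inv_diracMatrix_apply_same_flavour U mq hall f p q]
    · push Not at hall
      obtain ⟨g, hg⟩ := hall
      have h0 : (diracMatrix U mq).det = 0 := by
        rw [det_diracMatrix]
        exact Finset.prod_eq_zero (Finset.mem_univ g) hg
      rw [Matrix.nonsing_inv_apply_not_isUnit _ (by rw [h0]; exact not_isUnit_zero), Matrix.zero_apply,
        norm_zero]
      exact norm_nonneg _
  have hprod : ∏ g, ‖(wilsonDirac (fundamentalRep (Fin 3)) U (mq g) 1).det‖ =
      ‖Df.det‖ * ∏ g ∈ Finset.univ.erase f, ‖(wilsonDirac (fundamentalRep (Fin 3)) U (mq g) 1).det‖ :=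
    (Finset.mul_prod_erase _ _ (Finset.mem_univ f)).symm
  rw [hprod]
  by_cases hdet : Df.det = 0
  · -- singular flavour: the propagator is junk `0`, both sides vanish / are non-negative
    have h0 : ‖Df⁻¹ p q‖ = 0 := by
      rw [Matrix.nonsing_inv_apply_not_isUnit _ (by rw [hdet]; exact not_isUnit_zero), Matrix.zero_apply,
        norm_zero]
    have hG0 : ‖(diracMatrix U mq)⁻¹ (quarkEquiv (f, p)) (quarkEquiv (f, q))‖ = 0 :=
      le_antisymm (hentry.trans h0.le) (norm_nonneg _)
    rw [hG0, Real.zero_rpow (by linarith), mul_zero]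
    exact mul_nonneg (mul_nonneg hB0 (Real.rpow_nonneg hA0 _)) (Real.rpow_nonneg (norm_nonneg _) _)
  · have hdpos : 0 < ‖Df.det‖ := norm_pos_iff.2 hdet
    -- `‖det‖ · x^{1+ε} ≤ ‖det‖ · ‖Df⁻¹ p q‖^{1+ε} = (‖det‖ ‖Df⁻¹ p q‖)^{1+ε} ‖det‖^{-ε}`
    have hkey : ‖Df.det‖ * ‖Df⁻¹ p q‖ ^ (1 + ε) = (‖Df.det‖ * ‖Df⁻¹ p q‖) ^ (1 + ε) * ‖Df.det‖ ^ (-ε) := by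
      rw [Real.mul_rpow hdpos.le (norm_nonneg _), mul_comm (‖Df.det‖ ^ (1 + ε)), mul_assoc,
        ← Real.rpow_add hdpos, show (1 + ε) + -ε = 1 by ring, Real.rpow_one, mul_comm]
    have hadj : ‖Df.det‖ * ‖Df⁻¹ p q‖ ≤ A := (norm_det_mul_norm_inv_apply_le Df p q).trans hA
    calc ‖Df.det‖ * (∏ g ∈ Finset.univ.erase f, ‖(wilsonDirac (fundamentalRep (Fin 3)) U (mq g) 1).det‖) *
          ‖(diracMatrix U mq)⁻¹ (quarkEquiv (f, p)) (quarkEquiv (f, q))‖ ^ (1 + ε)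
        ≤ ‖Df.det‖ * B * ‖Df⁻¹ p q‖ ^ (1 + ε) := by gcongr
      _ = B * ((‖Df.det‖ * ‖Df⁻¹ p q‖) ^ (1 + ε) * ‖Df.det‖ ^ (-ε)) := by rw [← hkey]; ring
      _ ≤ B * (A ^ (1 + ε) * ‖Df.det‖ ^ (-ε)) := by gcongr
      _ = B * A ^ (1 + ε) * ‖Df.det‖ ^ (-ε) := by ring

/-- Measurability of a propagator entry of the `N_f`-flavour matrix (determinant inverse times adjugate entry). -/
theorem measurable_norm_inv_diracMatrix_apply (mq : Fin Nf → ℝ) (i j : FermiIdx Nf L) :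
    Measurable fun U : GaugeConfig 4 L SU3 => ‖(diracMatrix U mq)⁻¹ i j‖ := by
  have hadj : Continuous fun U : GaugeConfig 4 L SU3 => (diracMatrix U mq).adjugate i j :=
    ((continuous_diracMatrix (S := L) mq).matrix_adjugate).matrix_elem i j
  have h1 : (fun U : GaugeConfig 4 L SU3 => (diracMatrix U mq)⁻¹ i j) =
      fun U => ((diracMatrix U mq).det)⁻¹ * (diracMatrix U mq).adjugate i j := by
    funext U; rw [Matrix.inv_def, Matrix.smul_apply, smul_eq_mul, Ring.inverse_eq_inv']
  have h2 : Measurable fun U : GaugeConfig 4 L SU3 => (diracMatrix U mq)⁻¹ i j := by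
    rw [h1]
    exact ((continuous_det_diracMatrix (S := L) mq).measurable.inv).mul hadj.measurable
  exact h2.norm

include h in
omit [NeZero L] in
/-- **Phase-quenched `(1+ε)`-moments of propagator entries are finite** (modulo the negative-moment input):
for `0 < ε < s₀`, every `N_f`, torus of side `L ≥ 4`, `β`, mass vector, flavour and index pair,
`U ↦ ‖G_f(p,q)(U)‖^{1+ε}` is integrable under `qcdLatticeMeasure L β mq`. -/
theorem entryMomentIntegrable_of :
    ∃ s₀ : ℝ, 0 < s₀ ∧ ∀ ε : ℝ, 0 < ε → ε < s₀ → ∀ (Nf L : ℕ) [NeZero L], 4 ≤ L →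
      ∀ (β : ℝ) (mq : Fin Nf → ℝ) (f : Fin Nf) (p q : TorusSite 4 L × Fin 3 × Fin 4),
        Integrable (fun U : GaugeConfig 4 L SU3 =>
          ‖(diracMatrix U mq)⁻¹ (quarkEquiv (f, p)) (quarkEquiv (f, q))‖ ^ (1 + ε)) (qcdLatticeMeasure L β mq) := by
  obtain ⟨s₀, hs₀, hneg⟩ := h
  refine ⟨s₀, hs₀, fun ε hε hεs Nf L _ hL β mq f p q => ?_⟩
  obtain ⟨hZ0, hZT⟩ := partitionFunction_fundamental_ne_zero_and_ne_top (S := L) β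
  haveI : IsFiniteMeasure (wilsonWeight (d := 4) (L := L) (fundamentalRep (Fin 3)) β) :=
    ⟨by simpa [partitionFunction] using hZT.lt_top⟩
  -- the integrand and its measurability
  set φ : GaugeConfig 4 L SU3 → ℝ := fun U =>
    ‖(diracMatrix U mq)⁻¹ (quarkEquiv (f, p)) (quarkEquiv (f, q))‖ ^ (1 + ε) with hφ
  have hφm : Measurable φ := (measurable_norm_inv_diracMatrix_apply mq _ _).pow_const _
  have hφ0 : ∀ U, 0 ≤ φ U := fun U => Real.rpow_nonneg (norm_nonneg _) _
  -- bounds on the compact configuration space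
  have hadjc : Continuous fun U : GaugeConfig 4 L SU3 =>
      ‖(wilsonDirac (fundamentalRep (Fin 3)) U (mq f) 1).adjugate p q‖ :=
    (((continuous_wilsonDirac (fundamentalRep (Fin 3)) (continuous_fundamentalRep (Fin 3)) (mq f) 1)
      |>.matrix_adjugate).matrix_elem p q).norm
  obtain ⟨A, hA⟩ : ∃ A : ℝ, ∀ U : GaugeConfig 4 L SU3,
      ‖(wilsonDirac (fundamentalRep (Fin 3)) U (mq f) 1).adjugate p q‖ ≤ A := by
    obtain ⟨U₀, -, hU₀⟩ := (isCompact_univ (X := GaugeConfig 4 L SU3)).exists_isMaxOn Set.univ_nonempty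
      hadjc.continuousOn
    exact ⟨_, fun U => hU₀ (Set.mem_univ U)⟩
  have hBc : Continuous fun U : GaugeConfig 4 L SU3 =>
      ∏ g ∈ Finset.univ.erase f, ‖(wilsonDirac (fundamentalRep (Fin 3)) U (mq g) 1).det‖ :=
    continuous_finsetProd _ fun g _ =>
      ((continuous_wilsonDirac (fundamentalRep (Fin 3)) (continuous_fundamentalRep (Fin 3)) (mq g) 1)
        |>.matrix_det).norm
  obtain ⟨B, hB⟩ : ∃ B : ℝ, ∀ U : GaugeConfig 4 L SU3,
      ∏ g ∈ Finset.univ.erase f, ‖(wilsonDirac (fundamentalRep (Fin 3)) U (mq g) 1).det‖ ≤ B := by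
    obtain ⟨U₀, -, hU₀⟩ := (isCompact_univ (X := GaugeConfig 4 L SU3)).exists_isMaxOn Set.univ_nonempty
      hBc.continuousOn
    exact ⟨_, fun U => hU₀ (Set.mem_univ U)⟩
  have hB0 : 0 ≤ B := (Finset.prod_nonneg fun g _ => norm_nonneg _).trans (hB (fun _ => 1))
  -- the dominating function, integrable against the un-normalised Wilson weight
  set g : GaugeConfig 4 L SU3 → ℝ := fun U =>
    B * A ^ (1 + ε) * ‖(wilsonDirac (fundamentalRep (Fin 3)) U (mq f) 1).det‖ ^ (-ε) with hg
  have hgi : Integrable g (wilsonWeight (d := 4) (L := L) (fundamentalRep (Fin 3)) β) := by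
    have hW : wilsonWeight (d := 4) (L := L) (fundamentalRep (Fin 3)) β =
        partitionFunction (d := 4) (L := L) (fundamentalRep (Fin 3)) β •
          wilsonMeasure (d := 4) (L := L) (fundamentalRep (Fin 3)) β := by
      rw [wilsonMeasure, smul_smul, ENNReal.mul_inv_cancel hZ0 hZT, one_smul]
    rw [hW]
    exact ((hneg ε hε hεs L hL β (mq f)).const_mul (B * A ^ (1 + ε))).smul_measure hZT
  -- integrability against `qcdLatticeWeight = (∏ |det|) · wilsonWeight`
  have hdens : Measurable fun U : GaugeConfig 4 L SU3 =>
      ENNReal.ofReal (∏ g, ‖fermionDet (wilsonDirac (fundamentalRep (Fin 3)) U (mq g) 1)‖) := by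
    have := measurable_norm_det_diracMatrix (S := L) mq
    simp_rw [norm_det_diracMatrix] at this
    exact this.ennreal_ofReal
  have hWint : Integrable φ (qcdLatticeWeight L β mq) := by
    rw [qcdLatticeWeight, integrable_withDensity_iff_integrable_smul' hdens
      (Eventually.of_forall fun _ => ENNReal.ofReal_lt_top)]
    refine hgi.mono' (((hdens.ennreal_toReal).smul hφm).aestronglyMeasurable) (Eventually.of_forall fun U => ?_)
    have h0 : 0 ≤ ∏ g, ‖fermionDet (wilsonDirac (fundamentalRep (Fin 3)) U (mq g) 1)‖ :=
      Finset.prod_nonneg fun g _ => norm_nonneg _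
    rw [ENNReal.toReal_ofReal h0, smul_eq_mul, Real.norm_eq_abs, abs_of_nonneg (mul_nonneg h0 (hφ0 U))]
    exact prod_norm_det_mul_entry_rpow_le U mq f p q hε (hA U) (hB U) hB0
  -- normalisation
  by_cases huniv : qcdLatticeWeight L β mq Set.univ = 0
  · have hzero : qcdLatticeWeight L β mq = 0 := Measure.measure_univ_eq_zero.1 huniv
    rw [qcdLatticeMeasure, hzero, smul_zero]
    exact integrable_zero_measure
  · rw [qcdLatticeMeasure]
    exact hWint.smul_measure (ENNReal.inv_ne_top.2 huniv)

end Input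

/-- **stub `stub_entryMomentIntegrableOf` (registered additive stub of crux stmt-QuantumFields-9151)** — the
integrability conjunct of `MinorMoments` at `r = 1`, with the negative-moment theorem (registered stub
`stub_wilsonDetNegMoment`) as an explicit hypothesis. -/
theorem stub_entryMomentIntegrableOf :
    (∃ s₀ : ℝ, 0 < s₀ ∧ ∀ s : ℝ, 0 < s → s < s₀ → ∀ (L : ℕ) [NeZero L], 4 ≤ L → ∀ (β M : ℝ),
      MeasureTheory.Integrable
        (fun U : GaugeConfig 4 L SU3 => ‖(wilsonDirac (fundamentalRep (Fin 3)) U M 1).det‖ ^ (-s))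
        (wilsonMeasure (fundamentalRep (Fin 3)) β)) →
    ∃ s₀ : ℝ, 0 < s₀ ∧ ∀ ε : ℝ, 0 < ε → ε < s₀ → ∀ (Nf L : ℕ) [NeZero L], 4 ≤ L →
      ∀ (β : ℝ) (mq : Fin Nf → ℝ) (f : Fin Nf) (p q : TorusSite 4 L × Fin 3 × Fin 4),
        MeasureTheory.Integrable (fun U : GaugeConfig 4 L SU3 =>
          ‖(diracMatrix U mq)⁻¹ (quarkEquiv (f, p)) (quarkEquiv (f, q))‖ ^ (1 + ε)) (qcdLatticeMeasure L β mq) :=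
  fun h => entryMomentIntegrable_of h

end Summit.QuantumFields.QCD.Cruxes.PhaseQuenchedFlavourDecay.CrossingSplitIntegrability

end
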